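import Mathlib.Data.NNRat.Order
import Mathlib.Data.Rat.Cast.Order
import Literature.AnabelianGeometry.EtaleTheta.Discharge.Sec3Cor38CriterionOTri
import Literature.AlgebraicGeometry.Frobenioids.ElementaryFrobeniusCompact
import Literature.AlgebraicGeometry.Frobenioids.PerfectionPreFrobenioid
import HarnessLib

/-!
# [EtTh] Corollary 3.8 (i) sub-DAG — row C38-L05, part (d), first half: the base-field-theoretic divisors
# `Φ^{bs-fld}(A) ⊆ Φ(A)` of a tempered Frobenioid as a TOTALLY ORDERED line (monoprime coordinates), and their
# roots in `Φ(A)^pf`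

Mochizuki, *The étale theta function …*, Publ. RIMS **45** (2009), Def. 3.6 (ii)(a) PDF p.77 ("the [necessarily
group-saturated] submonoid `Φ^{bs-fld} := (ℝ·Φ₀^cnst)|_D ×_{(Φ^{ℝ-log})^gp} Φ ⊆ Φ^{ℝ-log}` … is monoprime"),
Def. 3.6 (iv) p.78 ("base-field-theoretic if its zero divisor belongs to `Φ^{bs-fld}(−)`") and the proof of
Cor. 3.8, p.81 l.20–27 [cite: MochizukiEtTh2009, Def 3.6 p.77]; [FrdI] §0 p.10 (monoprime monoids
`≅ ℤ_{≥0}, ℚ_{≥0}, ℝ_{≥0}`), p.11 (perfection, saturation) [cite: MochizukiFrdI2008, §0 p.10].  abc-iut cell, layer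
L2, seat abc-iut-w5-d124; companion of `TemperedFrobenioidCor38Sub.lean` (p414329, plan/L2/SUBDAG-EtTh-Cor38.md
row **C38-L05**, sub-row L05d of §F), sequel of `Sec3Cor38CriterionOTri.lean`.

Monoid-level preliminaries on the divisor monoid `Φ(A)` of a tempered Frobenioid `C` and its submonoid of
base-field-theoretic elements (no Frobenioid theory in this file):
* `bsFldPf C W ⊆ Φ(W)^pf` — the roots `l^{1/N}` of base-field-theoretic `l ∈ Φ(W)`; membership is detected on
  any representative (`mk_mem_bsFldPf_iff`, by the root-closure of `ℝ·Φ₀^cnst`, `RealifiedDivisorMonoids.cnstR_root`);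
  `divOPf C W ⊆ bsFldPf C W` GIVEN Prop. 3.4 (ii) at monoid type `Λ` (`hP34Λ`, see `divO_subset_bsFld`);
* divisibility bookkeeping in the divisorial monoid `Φ(W)` and its (divisorial) perfection: roots of divisibilities,
  antisymmetry, quotients of base-field-theoretic elements are base-field-theoretic;
* **the line**: from the typed field `isMonoprime_bsFld` (`Φ^{bs-fld}(A) ≅ ℤ_{≥0}, ℚ_{≥0}` or `ℝ_{≥0}`) an additive,
  injective, order-reflecting coordinate `Φ^{bs-fld}(A) → ℝ` (`exists_lineCoord`), hence divisibility is TOTAL on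
  base-field-theoretic elements and on their roots (`bsFld_dvd_total`, `bsFldPf_dvd_total`).
HONEST FRAMING: refereed pre-IUT material; nothing here bears on [IUTchIII] Cor. 3.12.
-/

namespace Literature.AnabelianGeometry.EtaleTheta

open CategoryTheory Opposite Literature.AlgebraicGeometry.Frobenioids

universe u₀ v₀ u v w

variable {D₀ : Type u₀} [Category.{v₀} D₀] {V : FrdIMonoidStub.{w}}
  {T : RealifiedDivisorMonoids (D₀ := D₀) V} {D : Type u} [Category.{v} D] {VD : FrdICatStub.{u, v, w} D}

/-! ### §0 Monoprime monoids carry an additive injective order-reflecting coordinate into `ℝ` -/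

namespace Cor38Criterion

/-- In `Multiplicative K` for a canonically ordered additive monoid `K` (here `ℕ`, `ℚ_{≥0}`, `ℝ_{≥0}`),
divisibility is the order of `K`. [cite: MochizukiFrdI2008, §0 p.10] -/
theorem multiplicative_dvd_iff {K : Type*} [AddCommMonoid K] [PartialOrder K] [CanonicallyOrderedAdd K]
    (x y : Multiplicative K) : x ∣ y ↔ Multiplicative.toAdd x ≤ Multiplicative.toAdd y := by
  constructor
  · rintro ⟨c, rfl⟩
    exact le_iff_exists_add.mpr ⟨Multiplicative.toAdd c, toAdd_mul x c⟩
  · intro h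
    obtain ⟨c, hc⟩ := le_iff_exists_add.mp h
    exact ⟨Multiplicative.ofAdd c, Multiplicative.toAdd.injective (by rw [toAdd_mul, toAdd_ofAdd, hc])⟩

/-- Transport of "divisibility = order" along a multiplicative isomorphism onto `Multiplicative K`, through an
additive order embedding `K → ℝ`. [cite: MochizukiFrdI2008, §0 p.10] -/
theorem exists_lineCoord_of_mulEquiv {L : Type*} [CommMonoid L] {K : Type*} [AddCommMonoid K] [PartialOrder K]
    [CanonicallyOrderedAdd K] (e : L ≃* Multiplicative K) (ι : K → ℝ) (hadd : ∀ a b, ι (a + b) = ι a + ι b)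
    (hinj : Function.Injective ι) (hle : ∀ a b, ι a ≤ ι b ↔ a ≤ b) (hnn : ∀ a, 0 ≤ ι a) :
    ∃ c : L → ℝ, (∀ a b, c (a * b) = c a + c b) ∧ Function.Injective c ∧
      (∀ a b, a ∣ b ↔ c a ≤ c b) ∧ ∀ a, 0 ≤ c a := by
  refine ⟨fun a => ι (Multiplicative.toAdd (e a)), fun a b => ?_,
    fun a b h => e.injective (Multiplicative.toAdd.injective (hinj h)), fun a b => ?_, fun a => hnn _⟩
  · show ι (Multiplicative.toAdd (e (a * b))) = ι (Multiplicative.toAdd (e a)) + ι (Multiplicative.toAdd (e b))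
    rw [map_mul, toAdd_mul, hadd]
  · show a ∣ b ↔ ι (Multiplicative.toAdd (e a)) ≤ ι (Multiplicative.toAdd (e b))
    rw [hle, ← multiplicative_dvd_iff]
    exact (map_dvd_iff e).symm

/-- **A monoprime monoid has a line coordinate**: an additive, injective map `c : L → ℝ_{≥0} ⊆ ℝ` with
`a ∣ b ⟺ c a ≤ c b` ([FrdI] §0: `L ≅ ℤ_{≥0}`, `ℚ_{≥0}` or `ℝ_{≥0}`). [cite: MochizukiFrdI2008, §0 p.10] -/
theorem exists_lineCoord {L : Type w} [CommMonoid L] (h : IsMonoprime L) :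
    ∃ c : L → ℝ, (∀ a b, c (a * b) = c a + c b) ∧ Function.Injective c ∧
      (∀ a b, a ∣ b ↔ c a ≤ c b) ∧ ∀ a, 0 ≤ c a := by
  rcases h with ⟨⟨⟨e⟩⟩⟩ | ⟨⟨⟨e⟩⟩⟩ | ⟨⟨⟨e⟩⟩⟩
  · exact exists_lineCoord_of_mulEquiv e (fun n : ℕ => (n : ℝ)) (fun a b => Nat.cast_add a b)
      Nat.cast_injective (fun a b => Nat.cast_le) (fun a => Nat.cast_nonneg a)
  · refine exists_lineCoord_of_mulEquiv e (fun q : NNRat => ((q : ℚ) : ℝ)) (fun a b => ?_) (fun a b hab => ?_)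
      (fun a b => ?_) (fun a => ?_)
    · rw [NNRat.coe_add, Rat.cast_add]
    · exact NNRat.coe_injective (Rat.cast_injective hab)
    · rw [Rat.cast_le, NNRat.coe_le_coe]
    · exact Rat.cast_nonneg.mpr (NNRat.coe_nonneg a)
  · exact exists_lineCoord_of_mulEquiv e (fun r : NNReal => (r : ℝ)) (fun a b => NNReal.coe_add a b)
      NNReal.coe_injective (fun a b => NNReal.coe_le_coe) (fun a => a.2)

end Cor38Criterion

namespace TemperedFrobenioid

variable (C : TemperedFrobenioid T D VD)

/-! ### §1 Base-field-theoretic divisors and their roots -/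

/-- `bsFldPf C W ⊆ Φ(W)^pf`: the roots `l^{1/N}` in the perfection of the base-field-theoretic elements
`l ∈ Φ^{bs-fld}(W) ⊆ Φ(W)` (Def. 3.6 (ii)(a), (iv)) — the perfected counterpart of `Φ^{bs-fld}` through which the
criterion of Cor. 3.8 (stated in `C^pf`) is read. [cite: MochizukiEtTh2009, Def 3.6 p.78] -/
def bsFldPf (W : D) : Set (Perfection (C.divisorMonoid.obj (op W))) :=
  {y | ∃ (l : C.divisorMonoid.obj (op W)) (N : ℕ+), C.IsBaseFieldTheoreticDiv l ∧ y = Perfection.mk l N}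

variable {C}

/-- Membership in `Φ^{bs-fld}(A)`, unfolded: the element of `Φ(A) ⊆ Φ^{ℝ-log}(A)` maps into `ℝ·Φ₀^cnst(Y_A)`
under `Φ^{ℝ-log}(A) → (Φ^{ℝ-log})^gp(A)`. [cite: MochizukiEtTh2009, Def 3.6 p.77] -/
theorem isBaseFieldTheoreticDiv_iff {A : Dᵒᵖ} (x : C.Φ.carrier A) :
    C.IsBaseFieldTheoreticDiv x ↔ Algebra.GrothendieckGroup.of (x : C.ΦRlog.obj A) ∈ T.cnstR (C.baseOp A) :=
  ⟨fun h => h.2, fun h => ⟨x.2, h⟩⟩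

/-- `1 ∈ Φ^{bs-fld}(A)`. [cite: MochizukiEtTh2009, Def 3.6 p.77] -/
theorem isBaseFieldTheoreticDiv_one (A : Dᵒᵖ) : C.IsBaseFieldTheoreticDiv (1 : C.Φ.carrier A) :=
  (C.bsFld.carrier A).one_mem

/-- `Φ^{bs-fld}(A)` is closed under products. [cite: MochizukiEtTh2009, Def 3.6 p.77] -/
theorem isBaseFieldTheoreticDiv_mul {A : Dᵒᵖ} {x y : C.Φ.carrier A} (hx : C.IsBaseFieldTheoreticDiv x)
    (hy : C.IsBaseFieldTheoreticDiv y) : C.IsBaseFieldTheoreticDiv (x * y) :=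
  (C.bsFld.carrier A).mul_mem hx hy

/-- `Φ^{bs-fld}(A)` is closed under powers. [cite: MochizukiEtTh2009, Def 3.6 p.77] -/
theorem isBaseFieldTheoreticDiv_pow {A : Dᵒᵖ} {x : C.Φ.carrier A} (hx : C.IsBaseFieldTheoreticDiv x) (n : ℕ) :
    C.IsBaseFieldTheoreticDiv (x ^ n) := by
  have := (C.bsFld.carrier A).pow_mem hx n
  rwa [← SubmonoidClass.coe_pow] at this

/-- Root-closure: `x ^ n ∈ Φ^{bs-fld}(A)` with `n ≥ 1` forces `x ∈ Φ^{bs-fld}(A)` (`ℝ·Φ₀^cnst` is root-closed,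
`RealifiedDivisorMonoids.cnstR_root`). [cite: MochizukiEtTh2009, Def 3.6 p.76] -/
theorem isBaseFieldTheoreticDiv_of_pow {A : Dᵒᵖ} {x : C.Φ.carrier A} {n : ℕ} (hn : n ≠ 0)
    (hx : C.IsBaseFieldTheoreticDiv (x ^ n)) : C.IsBaseFieldTheoreticDiv x := by
  refine ⟨x.2, T.mem_cnstR_of_pow_mem _ hn ?_⟩
  rw [← map_pow, ← SubmonoidClass.coe_pow]
  exact hx.2

/-- Quotients of base-field-theoretic elements are base-field-theoretic: if `l' = l · w` in `Φ(A)` with `l, l'`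
base-field-theoretic, so is `w` (`ℝ·Φ₀^cnst` is a subgroup). [cite: MochizukiEtTh2009, Def 3.6 p.77] -/
theorem isBaseFieldTheoreticDiv_of_mul_eq {A : Dᵒᵖ} {l l' w : C.Φ.carrier A} (h : l * w = l')
    (hl : C.IsBaseFieldTheoreticDiv l) (hl' : C.IsBaseFieldTheoreticDiv l') : C.IsBaseFieldTheoreticDiv w := by
  refine ⟨w.2, ?_⟩
  change Algebra.GrothendieckGroup.of (w : C.ΦRlog.obj A) ∈ T.cnstR (C.baseOp A)
  have e : Algebra.GrothendieckGroup.of (w : C.ΦRlog.obj A) =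
      Algebra.GrothendieckGroup.of (l' : C.ΦRlog.obj A) * (Algebra.GrothendieckGroup.of (l : C.ΦRlog.obj A))⁻¹ := by
    rw [eq_mul_inv_iff_mul_eq, ← map_mul, ← Submonoid.coe_mul, mul_comm, h]
  rw [e]
  exact (T.cnstR _).mul_mem hl'.2 ((T.cnstR _).inv_mem hl.2)

/-- Membership of a root `l^{1/N}` in `bsFldPf` is read off ANY representative.
[cite: MochizukiEtTh2009, Def 3.6 p.78] -/
theorem mk_mem_bsFldPf_iff {W : D} (l : C.divisorMonoid.obj (op W)) (N : ℕ+) :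
    Perfection.mk l N ∈ C.bsFldPf W ↔ C.IsBaseFieldTheoreticDiv l := by
  refine ⟨?_, fun h => ⟨l, N, h, rfl⟩⟩
  rintro ⟨l', N', hl', h⟩
  obtain ⟨K, hK⟩ := Perfection.mk_eq_mk_iff.mp h
  have h1 : C.IsBaseFieldTheoreticDiv (l ^ ((K : ℕ) * (N' : ℕ))) := by
    rw [hK]; exact isBaseFieldTheoreticDiv_pow hl' _
  exact isBaseFieldTheoreticDiv_of_pow (Nat.mul_ne_zero K.ne_zero N'.ne_zero) h1

/-- `of l = l^{1/1} ∈ bsFldPf ⟺ l ∈ Φ^{bs-fld}`. [cite: MochizukiEtTh2009, Def 3.6 p.78] -/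
theorem of_mem_bsFldPf_iff {W : D} (l : C.divisorMonoid.obj (op W)) :
    Perfection.of _ l ∈ C.bsFldPf W ↔ C.IsBaseFieldTheoreticDiv l :=
  mk_mem_bsFldPf_iff l 1

/-- `bsFldPf` is closed under products. [cite: MochizukiEtTh2009, Def 3.6 p.78] -/
theorem mul_mem_bsFldPf {W : D} {y y' : Perfection (C.divisorMonoid.obj (op W))} (hy : y ∈ C.bsFldPf W)
    (hy' : y' ∈ C.bsFldPf W) : y * y' ∈ C.bsFldPf W := by
  obtain ⟨l, N, hl, rfl⟩ := hy
  obtain ⟨l', N', hl', rfl⟩ := hy'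
  rw [Perfection.mk_mul_mk]
  exact ⟨_, _, isBaseFieldTheoreticDiv_mul (isBaseFieldTheoreticDiv_pow hl _) (isBaseFieldTheoreticDiv_pow hl' _), rfl⟩

/-- Under Prop. 3.4 (ii) at monoid type `Λ` ("an element of `B₀^Λ(Y)` whose divisor is effective is a constant",
hypothesis `hP34Λ`), the divisor of a rational function with effective divisor is base-field-theoretic:
`divO C W ⊆ Φ^{bs-fld}(W)`. [cite: MochizukiEtTh2009, Prop 3.4 p.74] -/
theorem divO_subset_bsFld
    (hP34Λ : ∀ (Y : D₀ᵒᵖ) (b : T.BΛ.obj Y) (r : T.ΦR.obj Y),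
      T.divΛ Y b = Algebra.GrothendieckGroup.of r → b ∈ T.FΛ Y)
    {W : D} {Z : C.Φ.carrier (op W)} (hZ : Z ∈ C.divO W) : C.IsBaseFieldTheoreticDiv Z := by
  obtain ⟨u, hu⟩ := hZ
  change (u.1.2 : Algebra.GrothendieckGroup (C.Φ.carrier (op W))) = Algebra.GrothendieckGroup.of Z at hu
  have hb : T.divΛ (C.baseOp (op W)) u.1.1 = Algebra.GrothendieckGroup.of (Z : C.ΦRlog.obj (op W)) := by
    have := u.2
    change T.divΛ (C.baseOp (op W)) u.1.1 = C.ΦgpToRlog (op W) u.1.2 at this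
    rw [this, hu]
    exact gpMap_of _ _
  have hc := T.divΛ_mem_cnstR _ _ (hP34Λ _ _ _ hb)
  rw [hb] at hc
  exact ⟨Z.2, hc⟩

/-- Hence `divOPf C W ⊆ bsFldPf C W` under `hP34Λ`. [cite: MochizukiEtTh2009, Prop 3.4 p.74] -/
theorem divOPf_subset_bsFldPf
    (hP34Λ : ∀ (Y : D₀ᵒᵖ) (b : T.BΛ.obj Y) (r : T.ΦR.obj Y),
      T.divΛ Y b = Algebra.GrothendieckGroup.of r → b ∈ T.FΛ Y)
    (W : D) : C.divOPf W ⊆ C.bsFldPf W := by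
  rintro _ ⟨Z, N, hZ, rfl⟩
  exact ⟨Z, N, divO_subset_bsFld hP34Λ hZ, rfl⟩

/-- A constant rational function `u ∈ F(A)` has base-field-theoretic divisor: if `Div_B(u) = Div Z` then
`Z ∈ Φ^{bs-fld}(A)` (`F₀^Λ` maps into `ℝ·Φ₀^cnst`, `RealifiedDivisorMonoids.divΛ_mem_cnstR`).
[cite: MochizukiEtTh2009, Def 3.6 p.77] -/
theorem isBaseFieldTheoreticDiv_of_cnstFn {A : Dᵒᵖ} {u : (T.BΛ.obj (C.baseOp A) : Type w) ×
      Algebra.GrothendieckGroup (C.Φ.carrier A)} (hu : u ∈ C.cnstFn A) {Z : C.Φ.carrier A}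
    (hZ : u.2 = Algebra.GrothendieckGroup.of Z) : C.IsBaseFieldTheoreticDiv Z := by
  have hb : T.divΛ (C.baseOp A) u.1 = Algebra.GrothendieckGroup.of (Z : C.ΦRlog.obj A) := by
    have := hu.1
    change T.divΛ (C.baseOp A) u.1 = C.ΦgpToRlog A u.2 at this
    rw [this, hZ]
    exact gpMap_of _ _
  have hc : T.divΛ (C.baseOp A) u.1 ∈ T.cnstR (C.baseOp A) := T.divΛ_mem_cnstR _ _ hu.2
  rw [hb] at hc
  exact ⟨Z.2, hc⟩

/-! ### §2 Divisibility bookkeeping in `Φ(W)` (divisorial) and in `Φ(W)^pf` -/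

/-- `Φ(W)` is a divisorial monoid ([FrdI] Thm. 5.2 (ii) hypothesis, recorded in `hF`).
[cite: MochizukiFrdI2008, Def. 1.1 (i) p.19] -/
theorem isDivisorial_divisorMonoid_of_isFrobenioid (hF : PreFrobenioid.IsFrobenioid C.toElem) (W : D) :
    IsDivisorial (C.divisorMonoid.obj (op W)) :=
  hF.isPreFrobenioid.isDivisorial W

/-- Roots of divisibilities in the divisorial monoid `Φ(W)`: `a ^ n ∣ b ^ n` (`n ≥ 1`) implies `a ∣ b`.
[cite: MochizukiFrdI2008, §0 p.11] -/
theorem dvd_of_pow_dvd_pow (hF : PreFrobenioid.IsFrobenioid C.toElem) {W : D}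
    {a b : C.divisorMonoid.obj (op W)} {n : ℕ} (hn : 0 < n) (h : a ^ n ∣ b ^ n) : a ∣ b := by
  haveI := isIntegral_iff_isCancelMul.mp (isDivisorial_divisorMonoid_of_isFrobenioid hF W).isPreDivisorial.isIntegral
  exact (isDivisorial_divisorMonoid_of_isFrobenioid hF W).isPreDivisorial.isSaturated.dvd_of_pow_dvd_pow hn h

/-- Divisibility in `Φ(W)` passes to roots with a common index. [cite: MochizukiFrdI2008, §0 p.11] -/
theorem mk_dvd_mk_of_dvd {W : D} {a b : C.divisorMonoid.obj (op W)} (h : a ∣ b) (n : ℕ+) :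
    Perfection.mk a n ∣ Perfection.mk b n := by
  obtain ⟨c, rfl⟩ := h
  exact ⟨Perfection.mk c n, by rw [Perfection.mk_mul_mk, ← mul_pow, Perfection.mk_pow_mul]⟩

/-- `a^{1/N} ∣ b^{1/N'}` in `Φ(W)^pf` iff `a ^ N' ∣ b ^ N` in `Φ(W)`. [cite: MochizukiFrdI2008, §0 p.11] -/
theorem mk_dvd_mk_iff (hF : PreFrobenioid.IsFrobenioid C.toElem) {W : D} (a b : C.divisorMonoid.obj (op W))
    (N N' : ℕ+) : Perfection.mk a N ∣ Perfection.mk b N' ↔ a ^ (N' : ℕ) ∣ b ^ (N : ℕ) := by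
  rw [← Perfection.mk_pow_mul a N N', ← Perfection.mk_pow_mul b N' N, mul_comm N' N]
  constructor
  · intro h
    obtain ⟨K, hK⟩ := Perfection.exists_pow_dvd_pow_of_mk_dvd_mk h
    exact dvd_of_pow_dvd_pow hF K.pos hK
  · intro h
    exact mk_dvd_mk_of_dvd h _

/-- Antisymmetry of divisibility in the (divisorial) perfection `Φ(W)^pf`. [cite: MochizukiFrdI2008, §0 p.12] -/
theorem perfection_dvd_antisymm (hF : PreFrobenioid.IsFrobenioid C.toElem) {W : D}
    {y y' : Perfection (C.divisorMonoid.obj (op W))} (h : y ∣ y') (h' : y' ∣ y) : y = y' := by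
  have hd : IsDivisorial (Perfection (C.divisorMonoid.obj (op W))) := (isDivisorial_divisorMonoid_of_isFrobenioid hF W).perfection
  haveI := isIntegral_iff_isCancelMul.mp hd.isPreDivisorial.isIntegral
  exact dvd_antisymm_of_isSharp hd.isSharp h h'

/-! ### §3 The line: total order of base-field-theoretic divisors -/

/-- `Φ^{bs-fld}(A)` is monoprime (Def. 3.6 (ii)(a), the typed field `isMonoprime_bsFld`), as a statement about the
carrier of `C.bsFld`. [cite: MochizukiEtTh2009, Def 3.6 p.77] -/
theorem isMonoprime_bsFld_carrier (A : Dᵒᵖ) : IsMonoprime (C.bsFld.carrier A) := C.isMonoprime_bsFld A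

/-- **Line coordinates** on `Φ^{bs-fld}(A)`: an additive injective `c : Φ^{bs-fld}(A) → ℝ_{≥0}` with
`a ∣ b ⟺ c a ≤ c b`. [cite: MochizukiEtTh2009, Def 3.6 p.77] -/
theorem exists_lineCoord_bsFld (A : Dᵒᵖ) :
    ∃ c : C.bsFld.carrier A → ℝ, (∀ a b, c (a * b) = c a + c b) ∧ Function.Injective c ∧
      (∀ a b, a ∣ b ↔ c a ≤ c b) ∧ ∀ a, 0 ≤ c a :=
  Cor38Criterion.exists_lineCoord (isMonoprime_bsFld_carrier A)

/-- Divisibility of base-field-theoretic elements in `Φ(A)` is divisibility in `Φ^{bs-fld}(A)`.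
[cite: MochizukiEtTh2009, Def 3.6 p.77] -/
theorem dvd_iff_bsFld_dvd {A : Dᵒᵖ} {l l' : C.Φ.carrier A} (hl : C.IsBaseFieldTheoreticDiv l)
    (hl' : C.IsBaseFieldTheoreticDiv l') :
    l ∣ l' ↔ (⟨(l : C.ΦRlog.obj A), hl⟩ : C.bsFld.carrier A) ∣ ⟨(l' : C.ΦRlog.obj A), hl'⟩ := by
  constructor
  · rintro ⟨w, hw⟩
    refine ⟨⟨(w : C.ΦRlog.obj A), isBaseFieldTheoreticDiv_of_mul_eq hw.symm hl hl'⟩, Subtype.ext ?_⟩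
    exact (congrArg Subtype.val hw :)
  · rintro ⟨w, hw⟩
    refine ⟨⟨(w : C.ΦRlog.obj A), w.2.1⟩, Subtype.ext ?_⟩
    exact (congrArg Subtype.val hw :)

/-- Divisibility is TOTAL on base-field-theoretic elements of `Φ(A)`. [cite: MochizukiEtTh2009, Def 3.6 p.77] -/
theorem bsFld_dvd_total {A : Dᵒᵖ} {l l' : C.Φ.carrier A} (hl : C.IsBaseFieldTheoreticDiv l)
    (hl' : C.IsBaseFieldTheoreticDiv l') : l ∣ l' ∨ l' ∣ l := by
  obtain ⟨c, -, -, hdvd, -⟩ := exists_lineCoord_bsFld (C := C) A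
  rw [dvd_iff_bsFld_dvd hl hl', dvd_iff_bsFld_dvd hl' hl, hdvd, hdvd]
  exact le_total _ _

/-- Divisibility is TOTAL on `bsFldPf`. [cite: MochizukiEtTh2009, Def 3.6 p.78] -/
theorem bsFldPf_dvd_total (hF : PreFrobenioid.IsFrobenioid C.toElem) {W : D}
    {y y' : Perfection (C.divisorMonoid.obj (op W))} (hy : y ∈ C.bsFldPf W) (hy' : y' ∈ C.bsFldPf W) :
    y ∣ y' ∨ y' ∣ y := by
  obtain ⟨l, N, hl, rfl⟩ := hy
  obtain ⟨l', N', hl', rfl⟩ := hy'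
  rw [mk_dvd_mk_iff hF, mk_dvd_mk_iff hF]
  exact bsFld_dvd_total (isBaseFieldTheoreticDiv_pow hl _) (isBaseFieldTheoreticDiv_pow hl' _)

end TemperedFrobenioid

end Literature.AnabelianGeometry.EtaleTheta
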